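import Mathlib.Analysis.Calculus.ParametricIntegral
import Mathlib.Analysis.Calculus.MeanValue
import Mathlib.Analysis.Calculus.Deriv.Inv
import Mathlib.Analysis.Calculus.Deriv.Mul
import Mathlib.MeasureTheory.Integral.IntervalIntegral.FundThmCalculus
import HarnessLib

/-!
# Crux `FluctuationComparisonRegPrIntL` (stmt-QuantumFields-20520, rung R3), PATH-B organ, H-currency cone — (L23) «LAW-EDGE RESPONSE = PATH COVARIANCE ∕
# PATH THIRD CUMULANT»: the NONLINEAR law-point response calculus of a normalised `τ`-density family on the organ's own carrier `(Z, τ)`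

Cell `ym3-torus` (YM ladder rung R3 = continuum `SU(2)` Yang–Mills on the three-torus — a RUNG: NOT d = 4, NOT infinite volume, NOT a mass gap, NOT Clay).
Width seat `ym-ust-20520-w5` (gen 24), `--supports stmt-QuantumFields-20520 --as helper`, count-neutral, no registry ∕ binder ∕ `Lines/` edit, DEFINITION-FREE,
default heartbeats.  MATHLIB-ONLY (`hasDerivAt_integral_of_dominated_loc_of_deriv_le`, `HasDerivAt.div`, `norm_image_sub_le_of_norm_deriv_le_segment_01'`,
`intervalIntegral.integral_eq_sub_of_hasDerivAt`) + HarnessLib, so that other cells (T⁴) can reuse §1–§3 (LEAD w3 g26 №18); the DOCK on the reviewed letters `wNum` ∕ `wgt`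
of ✓`…RunpairOrganFibreLawDefs` (p812742) is the companion file `…OrganTangentLawEdgeResponseDock` (§4 there).

WHY.  Every LAW bracket of the rows `SpreadFibreLawH` ∕ `SpreadFibreLawHJ` — (L1ʲ-h) `E_{W₂}[Δ₁F] − E_{U₂}[Δ₁F]`, (L2ʲ-h) `ΔΔ^{law} E_·[F_{V00}]`, (JV3-h′)
`Cov_{W₂}(Δ,S) − Cov_{U₂}(Δ,S)`, (JV4-h′) `ΔΔ^{law} Var_·[F_{V00}]` — moves the LAW POINT `X ↦ ŵ_t(X,·) = wNum(X,·) ∕ ∫ wNum(X,·) dτ` along a coarse bond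
`X_s = X·expPt(s•m′)@B′` with the integrand FROZEN.  That direction is NONLINEAR in `s` (`wNum(X_s, z) = χ(Φ)·ρ^t(Φ)·ρ′^{1−t}(Φ)·J` at `Φ(X_s, z)`), so the tree's
LINEAR-tilt response calculi (lit `T4CovarianceResponse.hasDerivAt_tiltMean` for `q₀e^{−θg}`; `TiltedCumulant.hasDerivAt_tiltedMean` and `AllWindowsColdBoxBoxHighLine.Tilt`
for Mathlib's `Measure.tilted`; `OrganTangentJensenGapTools` ∕ `OrganTangentCumulantTailTools` for the `t`-direction `cgf` Taylor formula) do not apply, and lit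
`T4CubeShellResponseStein.hasDerivAt_shellMean` (nonlinear) lives on the Lebesgue `cube n S` carrier.  This file is the ABSTRACT nonlinear edition on `(Z, τ)` for a
`τ`-density family `w : ℝ → Z → ℝ` with `s`-derivative `w′` — exactly `wgt`'s shape:

* §1 ★`hasDerivAt_integral_family` (`d∕ds ∫ w_s dτ = ∫ w′_s dτ`), `hasDerivAt_integral_mul_family` (same with a frozen factor `G`), ★`hasDerivAt_normMean`:
  `d∕ds (∫ G·w_s ∕ ∫ w_s) = (∫ G·w′_{s₀}) ∕ Z − ((∫ G·w_{s₀}) ∕ Z)·((∫ w′_{s₀}) ∕ Z)`, `Z = ∫ w_{s₀}` (dominated differentiation on a neighbourhood `S ∈ 𝓝 s₀` + the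
  quotient rule), and its COVARIANCE reading ★`normMean_deriv_eq_cov`: when `w_{s₀} ≠ 0` a.e., the derivative is `∫ G·r·ŵ dτ − (∫ G·ŵ dτ)·(∫ r·ŵ dτ)` with the SCORE
  `r := w′_{s₀} ∕ w_{s₀}` and the normalised law `ŵ := w_{s₀} ∕ Z` — «the law response of a frozen-integrand mean is the covariance of the integrand with the score
  under the SAME law».
* §2 ★`hasDerivAt_normCov`: for frozen `A B`, `s ↦ E_s[AB] − E_s[A]E_s[B]` has derivative `(N(AB) − E(AB)N(1)) − ((N(A) − E(A)N(1))·E(B) + E(A)·(N(B) − E(B)N(1)))`,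
  `E(X) := ∫ X·w_{s₀} ∕ Z`, `N(X) := ∫ X·w′_{s₀} ∕ Z` — the joint THIRD CUMULANT `κ₃(A, B, r)` once `N(X) = E(X·r)` (★`normCov_deriv_eq_cum3`); `integral_centred_mul_eq`
  and `integral_centred_mul3_eq` are the centred ↔ uncentred identities for `∫ ŵ = 1` (the rows' OWN-law centrings `c = ∫ …`).
* §3 integrated forms on `[0, 1]`: `abs_sub_le_of_hasDerivAt_of_abs_le` (mean value inequality), ★★`abs_normMean_one_sub_zero_le` — if the §1 data hold on an open
  `U ⊇ [0,1]` and the path covariance is `≤ ℓ` on `[0,1]` then `|E_{ŵ_1}[G] − E_{ŵ_0}[G]| ≤ ℓ` (the (L1ʲ-h) shape) — ★★`abs_normCov_one_sub_zero_le` (the (JV3-h′) shape),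
  and the exact form `normMean_one_sub_zero_eq_integral` (`= ∫₀¹` of the path covariance, when it is interval-integrable).
* §4 (companion file `…LawEdgeResponseDock`): `∫ f·(wgt … t V) dτ = (∫ f·wNum … t V dτ) ∕ (∫ wNum … t V dτ)`, so a discharger of (L1ʲ-h) ∕ (JV3-h′) instantiates
  `w s z := wNum … t (X s) z` along any law path `X : ℝ → GaugeField` and is left with ONE-LAW brackets `Cov_{ŵ_t(X_s)}(G, r_s)` ∕ `κ₃(A, B, r_s)`,
  `r_s = ∂_s log wNum(X_s, ·)`, uniformly in `s ∈ [0,1]` — «a covariance bound for transported first differences under the tilted fibre law» (LEAD census v5.0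
  §6 (b)) is then literally the remaining input.  Second-order law squares ((L2ʲ-h) ∕ (JV4-h′)) are NOT here (follow-up (L24)).

HONEST FRAMING: generic dominated-differentiation ∕ quotient-rule ∕ mean-value plumbing [folklore]; no letter is priced, no cumulant is bounded, no score is computed;
nothing of Bałaban's analysis is asserted or proved; `SpreadFibreLawH` ∕ `SpreadFibreLawHJ` are HYPOTHESIS rows; LIN″ ∕ JVAR″ ∕ JEN″ ∕ O1ᵘ-H v2.2 ∕ S1aᴴ ∕ S3ᴴ ∕ S2α′ ∕ S2β,
the five registered stubs of `Lines/semiclassical_s2beta.lean`, crux 20520 `FluctuationComparisonRegPrIntL` and `YM3TorusSU2` are NOT proved; registry untouched; rung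
R3 = SU(2) YM₃ on T³ at fixed lattice data — NOT d = 4, NOT infinite volume, NOT a mass gap, NOT Clay; the Yang–Mills mass gap is NOT proved.  [folklore].
-/

set_option autoImplicit false

noncomputable section

namespace Summit.QuantumFields.YangMills.Theorems.OrganTangentLawEdgeResponse

open MeasureTheory Filter Topology Set
open scoped ENNReal

/-! ## §1 Dominated differentiation of a `τ`-density family and the quotient rule: the law response of a frozen-integrand mean -/

section Abstract

variable {Z : Type*} [MeasurableSpace Z] {τ : Measure Z}

/-- ★ `d∕ds ∫ w_s dτ = ∫ w′_{s₀} dτ` at `s₀`: dominated differentiation under the integral for a real density family `w : ℝ → Z → ℝ` with `s`-derivative `w′`,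
an a.e. dominator `bound` of `w′` valid on a neighbourhood `S ∈ 𝓝 s₀` (Mathlib `hasDerivAt_integral_of_dominated_loc_of_deriv_le`). [folklore] -/
theorem hasDerivAt_integral_family {w w' : ℝ → Z → ℝ} {s₀ : ℝ} {S : Set ℝ} (hS : S ∈ 𝓝 s₀)
    (hmeas : ∀ s, AEStronglyMeasurable (w s) τ) (hint : Integrable (w s₀) τ)
    (hmeas' : AEStronglyMeasurable (w' s₀) τ)
    {bound : Z → ℝ} (hbound : ∀ᵐ z ∂τ, ∀ s ∈ S, |w' s z| ≤ bound z) (hbint : Integrable bound τ)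
    (hdiff : ∀ᵐ z ∂τ, ∀ s ∈ S, HasDerivAt (fun s => w s z) (w' s z) s) :
    HasDerivAt (fun s => ∫ z, w s z ∂τ) (∫ z, w' s₀ z ∂τ) s₀ := by
  refine (hasDerivAt_integral_of_dominated_loc_of_deriv_le (μ := τ) (F := w) (F' := w') (bound := bound) hS
    (Eventually.of_forall hmeas) hint hmeas' ?_ hbint hdiff).2
  filter_upwards [hbound] with z hz s hs
  rw [Real.norm_eq_abs]
  exact hz s hs

/-- `d∕ds ∫ G·w_s dτ = ∫ G·w′_{s₀} dτ` for a FROZEN (i.e. `s`-independent) factor `G`, given an a.e. dominator of `G·w′` on `S ∈ 𝓝 s₀`. [folklore] -/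
theorem hasDerivAt_integral_mul_family {w w' : ℝ → Z → ℝ} {G : Z → ℝ} {s₀ : ℝ} {S : Set ℝ} (hS : S ∈ 𝓝 s₀)
    (hG : AEStronglyMeasurable G τ) (hmeas : ∀ s, AEStronglyMeasurable (w s) τ)
    (hintG : Integrable (fun z => G z * w s₀ z) τ) (hmeas' : AEStronglyMeasurable (w' s₀) τ)
    {boundG : Z → ℝ} (hboundG : ∀ᵐ z ∂τ, ∀ s ∈ S, |G z * w' s z| ≤ boundG z) (hbGint : Integrable boundG τ)
    (hdiff : ∀ᵐ z ∂τ, ∀ s ∈ S, HasDerivAt (fun s => w s z) (w' s z) s) :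
    HasDerivAt (fun s => ∫ z, G z * w s z ∂τ) (∫ z, G z * w' s₀ z ∂τ) s₀ := by
  refine (hasDerivAt_integral_of_dominated_loc_of_deriv_le (μ := τ) (F := fun s z => G z * w s z)
    (F' := fun s z => G z * w' s z) (bound := boundG) hS
    (Eventually.of_forall fun s => hG.mul (hmeas s)) hintG (hG.mul hmeas') ?_ hbGint ?_).2
  · filter_upwards [hboundG] with z hz s hs
    rw [Real.norm_eq_abs]
    exact hz s hs
  · filter_upwards [hdiff] with z hz s hs
    exact (hz s hs).const_mul (G z)

/-- ★ **THE LAW RESPONSE OF A FROZEN-INTEGRAND MEAN** (quotient rule on §1): with `Z := ∫ w_{s₀} dτ ≠ 0`,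
`d∕ds|_{s₀} (∫ G·w_s dτ ∕ ∫ w_s dτ) = (∫ G·w′_{s₀}) ∕ Z − ((∫ G·w_{s₀}) ∕ Z)·((∫ w′_{s₀}) ∕ Z)`.  Nonlinear-parameter edition of lit
`T4CovarianceResponse.hasDerivAt_tiltMean` (linear tilts) on an abstract carrier. [folklore] -/
theorem hasDerivAt_normMean {w w' : ℝ → Z → ℝ} {G : Z → ℝ} {s₀ : ℝ} {S : Set ℝ} (hS : S ∈ 𝓝 s₀)
    (hG : AEStronglyMeasurable G τ) (hmeas : ∀ s, AEStronglyMeasurable (w s) τ)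
    (hint : Integrable (w s₀) τ) (hintG : Integrable (fun z => G z * w s₀ z) τ)
    (hmeas' : AEStronglyMeasurable (w' s₀) τ)
    {bound : Z → ℝ} (hbound : ∀ᵐ z ∂τ, ∀ s ∈ S, |w' s z| ≤ bound z) (hbint : Integrable bound τ)
    {boundG : Z → ℝ} (hboundG : ∀ᵐ z ∂τ, ∀ s ∈ S, |G z * w' s z| ≤ boundG z) (hbGint : Integrable boundG τ)
    (hdiff : ∀ᵐ z ∂τ, ∀ s ∈ S, HasDerivAt (fun s => w s z) (w' s z) s)
    (hZ : ∫ z, w s₀ z ∂τ ≠ 0) :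
    HasDerivAt (fun s => (∫ z, G z * w s z ∂τ) / (∫ z, w s z ∂τ))
      ((∫ z, G z * w' s₀ z ∂τ) / (∫ z, w s₀ z ∂τ)
        - ((∫ z, G z * w s₀ z ∂τ) / (∫ z, w s₀ z ∂τ)) * ((∫ z, w' s₀ z ∂τ) / (∫ z, w s₀ z ∂τ))) s₀ := by
  have hN := hasDerivAt_integral_mul_family hS hG hmeas hintG hmeas' hboundG hbGint hdiff
  have hD := hasDerivAt_integral_family hS hmeas hint hmeas' hbound hbint hdiff
  have heq : ((∫ z, G z * w' s₀ z ∂τ) * (∫ z, w s₀ z ∂τ) - (∫ z, G z * w s₀ z ∂τ) * (∫ z, w' s₀ z ∂τ)) / (∫ z, w s₀ z ∂τ) ^ 2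
      = (∫ z, G z * w' s₀ z ∂τ) / (∫ z, w s₀ z ∂τ)
        - ((∫ z, G z * w s₀ z ∂τ) / (∫ z, w s₀ z ∂τ)) * ((∫ z, w' s₀ z ∂τ) / (∫ z, w s₀ z ∂τ)) := by
    field_simp
  rw [← heq]
  exact hN.div hD hZ

/-- `∫ G·(w ∕ c) dτ = (∫ G·w dτ) ∕ c` (Mathlib `integral_div`). [folklore] -/
theorem integral_mul_div_const (G v : Z → ℝ) (c : ℝ) : (∫ z, G z * (v z / c) ∂τ) = (∫ z, G z * v z ∂τ) / c := by
  rw [← integral_div]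
  exact integral_congr_ae (Eventually.of_forall fun z => by ring)

/-- ★ **COVARIANCE READING OF THE RESPONSE.**  If `w_{s₀} ≠ 0` `τ`-a.e., the derivative of ★`hasDerivAt_normMean` equals
`∫ G·r·ŵ dτ − (∫ G·ŵ dτ)·(∫ r·ŵ dτ)` with the SCORE `r := w′_{s₀} ∕ w_{s₀}` and the normalised law `ŵ := w_{s₀} ∕ Z` — the covariance of the frozen integrand with
the score under the SAME law (pure algebra under the integral; no integrability needed). [folklore] -/
theorem normMean_deriv_eq_cov {w w' : ℝ → Z → ℝ} {G : Z → ℝ} {s₀ : ℝ} (hw : ∀ᵐ z ∂τ, w s₀ z ≠ 0) :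
    (∫ z, G z * w' s₀ z ∂τ) / (∫ z, w s₀ z ∂τ)
        - ((∫ z, G z * w s₀ z ∂τ) / (∫ z, w s₀ z ∂τ)) * ((∫ z, w' s₀ z ∂τ) / (∫ z, w s₀ z ∂τ))
      = (∫ z, G z * (w' s₀ z / w s₀ z) * (w s₀ z / ∫ z', w s₀ z' ∂τ) ∂τ)
        - (∫ z, G z * (w s₀ z / ∫ z', w s₀ z' ∂τ) ∂τ) * (∫ z, (w' s₀ z / w s₀ z) * (w s₀ z / ∫ z', w s₀ z' ∂τ) ∂τ) := by
  have h1 : (∫ z, G z * (w' s₀ z / w s₀ z) * (w s₀ z / ∫ z', w s₀ z' ∂τ) ∂τ)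
      = (∫ z, G z * w' s₀ z ∂τ) / (∫ z, w s₀ z ∂τ) := by
    rw [← integral_div]
    refine integral_congr_ae ?_
    filter_upwards [hw] with z hz
    field_simp
  have h2 : (∫ z, G z * (w s₀ z / ∫ z', w s₀ z' ∂τ) ∂τ) = (∫ z, G z * w s₀ z ∂τ) / (∫ z, w s₀ z ∂τ) :=
    integral_mul_div_const _ _ _
  have h3 : (∫ z, (w' s₀ z / w s₀ z) * (w s₀ z / ∫ z', w s₀ z' ∂τ) ∂τ) = (∫ z, w' s₀ z ∂τ) / (∫ z, w s₀ z ∂τ) := by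
    rw [← integral_div]
    refine integral_congr_ae ?_
    filter_upwards [hw] with z hz
    field_simp
  rw [h1, h2, h3]

/-! ## §2 The law response of a covariance: the path third cumulant -/

/-- Calculus core: `e_{AB} − e_A·e_B` differentiates to `d_{AB} − (d_A·e_B + e_A·d_B)`. [folklore] -/
theorem hasDerivAt_sub_mul {eAB eA eB : ℝ → ℝ} {dAB dA dB s₀ : ℝ} (hAB : HasDerivAt eAB dAB s₀) (hA : HasDerivAt eA dA s₀) (hB : HasDerivAt eB dB s₀) :
    HasDerivAt (fun s => eAB s - eA s * eB s) (dAB - (dA * eB s₀ + eA s₀ * dB)) s₀ :=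
  hAB.sub (hA.mul hB)

/-- ★ **THE LAW RESPONSE OF A COVARIANCE** (frozen `A B`, moving law `ŵ_s = w_s ∕ ∫ w_s`): the uncentred covariance `s ↦ E_s[AB] − E_s[A]·E_s[B]`,
`E_s[X] := ∫ X·w_s ∕ ∫ w_s`, has derivative `(N(AB) − E(AB)·N(1)) − ((N(A) − E(A)·N(1))·E(B) + E(A)·(N(B) − E(B)·N(1)))` at `s₀`, where `E(X) := ∫ X·w_{s₀} ∕ Z`,
`N(X) := ∫ X·w′_{s₀} ∕ Z`, `N(1) := ∫ w′_{s₀} ∕ Z`, `Z := ∫ w_{s₀} ≠ 0` (three instances of ★`hasDerivAt_normMean`).  This is the joint third cumulant `κ₃(A, B, r)` of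
`A, B` and the score — see `normCov_deriv_eq_cum3`. [folklore] -/
theorem hasDerivAt_normCov {w w' : ℝ → Z → ℝ} {A B : Z → ℝ} {s₀ : ℝ} {S : Set ℝ} (hS : S ∈ 𝓝 s₀)
    (hA : AEStronglyMeasurable A τ) (hB : AEStronglyMeasurable B τ) (hmeas : ∀ s, AEStronglyMeasurable (w s) τ)
    (hint : Integrable (w s₀) τ) (hintA : Integrable (fun z => A z * w s₀ z) τ) (hintB : Integrable (fun z => B z * w s₀ z) τ)
    (hintAB : Integrable (fun z => (A z * B z) * w s₀ z) τ)
    (hmeas' : AEStronglyMeasurable (w' s₀) τ)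
    {bound : Z → ℝ} (hbound : ∀ᵐ z ∂τ, ∀ s ∈ S, |w' s z| ≤ bound z) (hbint : Integrable bound τ)
    {boundA : Z → ℝ} (hboundA : ∀ᵐ z ∂τ, ∀ s ∈ S, |A z * w' s z| ≤ boundA z) (hbAint : Integrable boundA τ)
    {boundB : Z → ℝ} (hboundB : ∀ᵐ z ∂τ, ∀ s ∈ S, |B z * w' s z| ≤ boundB z) (hbBint : Integrable boundB τ)
    {boundAB : Z → ℝ} (hboundAB : ∀ᵐ z ∂τ, ∀ s ∈ S, |(A z * B z) * w' s z| ≤ boundAB z) (hbABint : Integrable boundAB τ)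
    (hdiff : ∀ᵐ z ∂τ, ∀ s ∈ S, HasDerivAt (fun s => w s z) (w' s z) s)
    (hZ : ∫ z, w s₀ z ∂τ ≠ 0) :
    HasDerivAt (fun s => (∫ z, (A z * B z) * w s z ∂τ) / (∫ z, w s z ∂τ)
        - ((∫ z, A z * w s z ∂τ) / (∫ z, w s z ∂τ)) * ((∫ z, B z * w s z ∂τ) / (∫ z, w s z ∂τ)))
      (((∫ z, (A z * B z) * w' s₀ z ∂τ) / (∫ z, w s₀ z ∂τ)
          - ((∫ z, (A z * B z) * w s₀ z ∂τ) / (∫ z, w s₀ z ∂τ)) * ((∫ z, w' s₀ z ∂τ) / (∫ z, w s₀ z ∂τ)))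
        - (((∫ z, A z * w' s₀ z ∂τ) / (∫ z, w s₀ z ∂τ)
              - ((∫ z, A z * w s₀ z ∂τ) / (∫ z, w s₀ z ∂τ)) * ((∫ z, w' s₀ z ∂τ) / (∫ z, w s₀ z ∂τ)))
            * ((∫ z, B z * w s₀ z ∂τ) / (∫ z, w s₀ z ∂τ))
          + ((∫ z, A z * w s₀ z ∂τ) / (∫ z, w s₀ z ∂τ))
            * ((∫ z, B z * w' s₀ z ∂τ) / (∫ z, w s₀ z ∂τ)
              - ((∫ z, B z * w s₀ z ∂τ) / (∫ z, w s₀ z ∂τ)) * ((∫ z, w' s₀ z ∂τ) / (∫ z, w s₀ z ∂τ))))) s₀ := by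
  have hAB' : AEStronglyMeasurable (fun z => A z * B z) τ := hA.mul hB
  exact hasDerivAt_sub_mul
    (hasDerivAt_normMean hS hAB' hmeas hint hintAB hmeas' hbound hbint hboundAB hbABint hdiff hZ)
    (hasDerivAt_normMean hS hA hmeas hint hintA hmeas' hbound hbint hboundA hbAint hdiff hZ)
    (hasDerivAt_normMean hS hB hmeas hint hintB hmeas' hbound hbint hboundB hbBint hdiff hZ)

/-- Centred ↔ uncentred, two factors: with `∫ ŵ = 1`, `∫ (A − E[A])(B − E[B])·ŵ = E[AB] − E[A]·E[B]` (`E[X] := ∫ X·ŵ`) — the rows' OWN-law centrings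
`c = ∫ …` read as uncentred covariances. [folklore] -/
theorem integral_centred_mul_eq {ŵ A B : Z → ℝ} (h1 : ∫ z, ŵ z ∂τ = 1)
    (hA : Integrable (fun z => A z * ŵ z) τ) (hB : Integrable (fun z => B z * ŵ z) τ)
    (hAB : Integrable (fun z => A z * B z * ŵ z) τ) (hw : Integrable ŵ τ) :
    ∫ z, (A z - ∫ z', A z' * ŵ z' ∂τ) * (B z - ∫ z', B z' * ŵ z' ∂τ) * ŵ z ∂τ
      = (∫ z, A z * B z * ŵ z ∂τ) - (∫ z, A z * ŵ z ∂τ) * (∫ z, B z * ŵ z ∂τ) := by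
  set a := ∫ z', A z' * ŵ z' ∂τ with ha
  set b := ∫ z', B z' * ŵ z' ∂τ with hb
  have hexp : (fun z => (A z - a) * (B z - b) * ŵ z)
      = fun z => ((A z * B z * ŵ z - b * (A z * ŵ z)) - a * (B z * ŵ z)) + (a * b) * ŵ z := by
    funext z; ring
  have I2 : Integrable (fun z => b * (A z * ŵ z)) τ := hA.const_mul b
  have I3 : Integrable (fun z => a * (B z * ŵ z)) τ := hB.const_mul a
  have I4 : Integrable (fun z => (a * b) * ŵ z) τ := hw.const_mul (a * b)
  have I12 : Integrable (fun z => A z * B z * ŵ z - b * (A z * ŵ z)) τ := hAB.sub I2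
  have I123 : Integrable (fun z => (A z * B z * ŵ z - b * (A z * ŵ z)) - a * (B z * ŵ z)) τ := I12.sub I3
  rw [hexp, integral_add I123 I4, integral_sub I12 I3, integral_sub hAB I2,
    integral_const_mul, integral_const_mul, integral_const_mul, h1]
  ring

/-- ★ **THIRD-CUMULANT READING** (centred ↔ uncentred, three factors): with `∫ ŵ = 1` and `E[X] := ∫ X·ŵ`, the §2 derivative in score form —
`(E[ABR] − E[AB]E[R]) − ((E[AR] − E[A]E[R])·E[B] + E[A]·(E[BR] − E[B]E[R]))` — IS the centred joint third moment `∫ (A − E[A])(B − E[B])(R − E[R])·ŵ`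
(the joint third cumulant `κ₃(A, B, R)`; all products integrable).  Pure linearity of the integral. [folklore] -/
theorem integral_centred_mul3_eq {ŵ A B R : Z → ℝ} (h1 : ∫ z, ŵ z ∂τ = 1)
    (hA : Integrable (fun z => A z * ŵ z) τ) (hB : Integrable (fun z => B z * ŵ z) τ) (hR : Integrable (fun z => R z * ŵ z) τ)
    (hAB : Integrable (fun z => A z * B z * ŵ z) τ) (hAR : Integrable (fun z => A z * R z * ŵ z) τ)
    (hBR : Integrable (fun z => B z * R z * ŵ z) τ) (hABR : Integrable (fun z => A z * B z * R z * ŵ z) τ)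
    (hw : Integrable ŵ τ) :
    ∫ z, (A z - ∫ z', A z' * ŵ z' ∂τ) * (B z - ∫ z', B z' * ŵ z' ∂τ) * (R z - ∫ z', R z' * ŵ z' ∂τ) * ŵ z ∂τ
      = ((∫ z, A z * B z * R z * ŵ z ∂τ) - (∫ z, A z * B z * ŵ z ∂τ) * (∫ z, R z * ŵ z ∂τ))
        - (((∫ z, A z * R z * ŵ z ∂τ) - (∫ z, A z * ŵ z ∂τ) * (∫ z, R z * ŵ z ∂τ)) * (∫ z, B z * ŵ z ∂τ)
          + (∫ z, A z * ŵ z ∂τ) * ((∫ z, B z * R z * ŵ z ∂τ) - (∫ z, B z * ŵ z ∂τ) * (∫ z, R z * ŵ z ∂τ))) := by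
  set a := ∫ z', A z' * ŵ z' ∂τ with ha
  set b := ∫ z', B z' * ŵ z' ∂τ with hb
  set c := ∫ z', R z' * ŵ z' ∂τ with hc
  have hexp : (fun z => (A z - a) * (B z - b) * (R z - c) * ŵ z)
      = fun z => (((A z * B z * R z * ŵ z - c * (A z * B z * ŵ z)) - b * (A z * R z * ŵ z)) - a * (B z * R z * ŵ z))
        + (((b * c) * (A z * ŵ z) + (a * c) * (B z * ŵ z)) + ((a * b) * (R z * ŵ z) - (a * b * c) * ŵ z)) := by
    funext z; ring
  have I2 : Integrable (fun z => c * (A z * B z * ŵ z)) τ := hAB.const_mul c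
  have I3 : Integrable (fun z => b * (A z * R z * ŵ z)) τ := hAR.const_mul b
  have I4 : Integrable (fun z => a * (B z * R z * ŵ z)) τ := hBR.const_mul a
  have I5 : Integrable (fun z => (b * c) * (A z * ŵ z)) τ := hA.const_mul (b * c)
  have I6 : Integrable (fun z => (a * c) * (B z * ŵ z)) τ := hB.const_mul (a * c)
  have I7 : Integrable (fun z => (a * b) * (R z * ŵ z)) τ := hR.const_mul (a * b)
  have I8 : Integrable (fun z => (a * b * c) * ŵ z) τ := hw.const_mul (a * b * c)
  have I12 : Integrable (fun z => A z * B z * R z * ŵ z - c * (A z * B z * ŵ z)) τ := hABR.sub I2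
  have I123 : Integrable (fun z => (A z * B z * R z * ŵ z - c * (A z * B z * ŵ z)) - b * (A z * R z * ŵ z)) τ := I12.sub I3
  have I1234 : Integrable (fun z => ((A z * B z * R z * ŵ z - c * (A z * B z * ŵ z)) - b * (A z * R z * ŵ z)) - a * (B z * R z * ŵ z)) τ := I123.sub I4
  have I56 : Integrable (fun z => (b * c) * (A z * ŵ z) + (a * c) * (B z * ŵ z)) τ := I5.add I6
  have I78 : Integrable (fun z => (a * b) * (R z * ŵ z) - (a * b * c) * ŵ z) τ := I7.sub I8
  have I5678 : Integrable (fun z => ((b * c) * (A z * ŵ z) + (a * c) * (B z * ŵ z)) + ((a * b) * (R z * ŵ z) - (a * b * c) * ŵ z)) τ := I56.add I78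
  rw [hexp, integral_add I1234 I5678, integral_sub I123 I4, integral_sub I12 I3, integral_sub hABR I2,
    integral_add I56 I78, integral_add I5 I6, integral_sub I7 I8,
    integral_const_mul, integral_const_mul, integral_const_mul, integral_const_mul, integral_const_mul, integral_const_mul,
    integral_const_mul, h1]
  ring

/-- `normCov_deriv_eq_cum3`: under `w_{s₀} ≠ 0` a.e., each «`N(X) − E(X)·N(1)`» block of ★`hasDerivAt_normCov` is the own-law covariance `∫ X·r·ŵ − (∫ X·ŵ)(∫ r·ŵ)` of
`X ∈ {AB, A, B}` with the score `r = w′_{s₀} ∕ w_{s₀}` under `ŵ = w_{s₀} ∕ Z` (★`normMean_deriv_eq_cov` ×3); with `integral_centred_mul3_eq` this is `κ₃(A, B, r)`. [folklore] -/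
theorem normCov_deriv_eq_cum3 {w w' : ℝ → Z → ℝ} {A B : Z → ℝ} {s₀ : ℝ} (hw : ∀ᵐ z ∂τ, w s₀ z ≠ 0) :
    (((∫ z, (A z * B z) * w' s₀ z ∂τ) / (∫ z, w s₀ z ∂τ)
          - ((∫ z, (A z * B z) * w s₀ z ∂τ) / (∫ z, w s₀ z ∂τ)) * ((∫ z, w' s₀ z ∂τ) / (∫ z, w s₀ z ∂τ)))
        - (((∫ z, A z * w' s₀ z ∂τ) / (∫ z, w s₀ z ∂τ)
              - ((∫ z, A z * w s₀ z ∂τ) / (∫ z, w s₀ z ∂τ)) * ((∫ z, w' s₀ z ∂τ) / (∫ z, w s₀ z ∂τ)))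
            * ((∫ z, B z * w s₀ z ∂τ) / (∫ z, w s₀ z ∂τ))
          + ((∫ z, A z * w s₀ z ∂τ) / (∫ z, w s₀ z ∂τ))
            * ((∫ z, B z * w' s₀ z ∂τ) / (∫ z, w s₀ z ∂τ)
              - ((∫ z, B z * w s₀ z ∂τ) / (∫ z, w s₀ z ∂τ)) * ((∫ z, w' s₀ z ∂τ) / (∫ z, w s₀ z ∂τ)))))
      = ((∫ z, (A z * B z) * (w' s₀ z / w s₀ z) * (w s₀ z / ∫ z', w s₀ z' ∂τ) ∂τ)
          - (∫ z, (A z * B z) * (w s₀ z / ∫ z', w s₀ z' ∂τ) ∂τ) * (∫ z, (w' s₀ z / w s₀ z) * (w s₀ z / ∫ z', w s₀ z' ∂τ) ∂τ))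
        - (((∫ z, A z * (w' s₀ z / w s₀ z) * (w s₀ z / ∫ z', w s₀ z' ∂τ) ∂τ)
              - (∫ z, A z * (w s₀ z / ∫ z', w s₀ z' ∂τ) ∂τ) * (∫ z, (w' s₀ z / w s₀ z) * (w s₀ z / ∫ z', w s₀ z' ∂τ) ∂τ))
            * (∫ z, B z * (w s₀ z / ∫ z', w s₀ z' ∂τ) ∂τ)
          + (∫ z, A z * (w s₀ z / ∫ z', w s₀ z' ∂τ) ∂τ)
            * ((∫ z, B z * (w' s₀ z / w s₀ z) * (w s₀ z / ∫ z', w s₀ z' ∂τ) ∂τ)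
              - (∫ z, B z * (w s₀ z / ∫ z', w s₀ z' ∂τ) ∂τ) * (∫ z, (w' s₀ z / w s₀ z) * (w s₀ z / ∫ z', w s₀ z' ∂τ) ∂τ))) := by
  rw [normMean_deriv_eq_cov (G := fun z => A z * B z) hw, normMean_deriv_eq_cov (G := A) hw, normMean_deriv_eq_cov (G := B) hw,
    integral_mul_div_const A (w s₀), integral_mul_div_const B (w s₀)]

/-! ## §3 Integrated forms on `[0, 1]` (the law EDGE) -/

/-- Mean value inequality on `[0,1]`: `|f 1 − f 0| ≤ ℓ` from `|f′| ≤ ℓ` on `[0,1]` (Mathlib `norm_image_sub_le_of_norm_deriv_le_segment_01'`). [folklore] -/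
theorem abs_sub_le_of_hasDerivAt_of_abs_le {f f' : ℝ → ℝ} {ℓ : ℝ}
    (hf : ∀ s ∈ Icc (0:ℝ) 1, HasDerivAt f (f' s) s) (hb : ∀ s ∈ Icc (0:ℝ) 1, |f' s| ≤ ℓ) :
    |f 1 - f 0| ≤ ℓ := by
  have h := norm_image_sub_le_of_norm_deriv_le_segment_01' (fun s hs => (hf s hs).hasDerivWithinAt)
    (fun s hs => by rw [Real.norm_eq_abs]; exact hb s (Ico_subset_Icc_self hs))
  rwa [Real.norm_eq_abs] at h

/-- Exact form: `f 1 − f 0 = ∫₀¹ f′` when `f′` is interval-integrable (FTC-2). [folklore] -/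
theorem sub_eq_integral_of_hasDerivAt {f f' : ℝ → ℝ}
    (hf : ∀ s ∈ Icc (0:ℝ) 1, HasDerivAt f (f' s) s) (hi : IntervalIntegrable f' volume 0 1) :
    f 1 - f 0 = ∫ s in (0:ℝ)..1, f' s := by
  rw [intervalIntegral.integral_eq_sub_of_hasDerivAt (fun s hs => hf s (by rwa [uIcc_of_le zero_le_one] at hs)) hi]

/-- ★★ **THE LAW EDGE OF A FROZEN-INTEGRAND MEAN IS BOUNDED BY THE PATH COVARIANCE** (the (L1ʲ-h) shape): if the §1 data hold on an open `U ⊇ [0,1]`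
(masses non-zero on `[0,1]`) and the path covariance `(∫ G·w′_s) ∕ Z_s − ((∫ G·w_s) ∕ Z_s)·((∫ w′_s) ∕ Z_s)` is `≤ ℓ` in absolute value for every `s ∈ [0,1]`, then
`|E_{ŵ_1}[G] − E_{ŵ_0}[G]| ≤ ℓ`. [folklore] -/
theorem abs_normMean_one_sub_zero_le {w w' : ℝ → Z → ℝ} {G : Z → ℝ} {U : Set ℝ} (hU : IsOpen U) (hUI : Icc (0:ℝ) 1 ⊆ U)
    (hG : AEStronglyMeasurable G τ) (hmeas : ∀ s, AEStronglyMeasurable (w s) τ) (hmeas' : ∀ s, AEStronglyMeasurable (w' s) τ)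
    (hint : ∀ s ∈ Icc (0:ℝ) 1, Integrable (w s) τ) (hintG : ∀ s ∈ Icc (0:ℝ) 1, Integrable (fun z => G z * w s z) τ)
    {bound : Z → ℝ} (hbound : ∀ᵐ z ∂τ, ∀ s ∈ U, |w' s z| ≤ bound z) (hbint : Integrable bound τ)
    {boundG : Z → ℝ} (hboundG : ∀ᵐ z ∂τ, ∀ s ∈ U, |G z * w' s z| ≤ boundG z) (hbGint : Integrable boundG τ)
    (hdiff : ∀ᵐ z ∂τ, ∀ s ∈ U, HasDerivAt (fun s => w s z) (w' s z) s)
    (hZ : ∀ s ∈ Icc (0:ℝ) 1, ∫ z, w s z ∂τ ≠ 0) {ℓ : ℝ}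
    (hcov : ∀ s ∈ Icc (0:ℝ) 1, |(∫ z, G z * w' s z ∂τ) / (∫ z, w s z ∂τ)
        - ((∫ z, G z * w s z ∂τ) / (∫ z, w s z ∂τ)) * ((∫ z, w' s z ∂τ) / (∫ z, w s z ∂τ))| ≤ ℓ) :
    |(∫ z, G z * w 1 z ∂τ) / (∫ z, w 1 z ∂τ) - (∫ z, G z * w 0 z ∂τ) / (∫ z, w 0 z ∂τ)| ≤ ℓ :=
  abs_sub_le_of_hasDerivAt_of_abs_le (f := fun s => (∫ z, G z * w s z ∂τ) / (∫ z, w s z ∂τ))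
    (fun s hs => hasDerivAt_normMean (hU.mem_nhds (hUI hs)) hG hmeas (hint s hs) (hintG s hs) (hmeas' s) hbound hbint
      hboundG hbGint hdiff (hZ s hs)) hcov

/-- The exact form of the law edge: `E_{ŵ_1}[G] − E_{ŵ_0}[G] = ∫₀¹ (path covariance) ds`, when the path covariance is interval-integrable on `[0,1]`. [folklore] -/
theorem normMean_one_sub_zero_eq_integral {w w' : ℝ → Z → ℝ} {G : Z → ℝ} {U : Set ℝ} (hU : IsOpen U) (hUI : Icc (0:ℝ) 1 ⊆ U)
    (hG : AEStronglyMeasurable G τ) (hmeas : ∀ s, AEStronglyMeasurable (w s) τ) (hmeas' : ∀ s, AEStronglyMeasurable (w' s) τ)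
    (hint : ∀ s ∈ Icc (0:ℝ) 1, Integrable (w s) τ) (hintG : ∀ s ∈ Icc (0:ℝ) 1, Integrable (fun z => G z * w s z) τ)
    {bound : Z → ℝ} (hbound : ∀ᵐ z ∂τ, ∀ s ∈ U, |w' s z| ≤ bound z) (hbint : Integrable bound τ)
    {boundG : Z → ℝ} (hboundG : ∀ᵐ z ∂τ, ∀ s ∈ U, |G z * w' s z| ≤ boundG z) (hbGint : Integrable boundG τ)
    (hdiff : ∀ᵐ z ∂τ, ∀ s ∈ U, HasDerivAt (fun s => w s z) (w' s z) s)
    (hZ : ∀ s ∈ Icc (0:ℝ) 1, ∫ z, w s z ∂τ ≠ 0)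
    (hi : IntervalIntegrable (fun s => (∫ z, G z * w' s z ∂τ) / (∫ z, w s z ∂τ)
        - ((∫ z, G z * w s z ∂τ) / (∫ z, w s z ∂τ)) * ((∫ z, w' s z ∂τ) / (∫ z, w s z ∂τ))) volume 0 1) :
    (∫ z, G z * w 1 z ∂τ) / (∫ z, w 1 z ∂τ) - (∫ z, G z * w 0 z ∂τ) / (∫ z, w 0 z ∂τ)
      = ∫ s in (0:ℝ)..1, ((∫ z, G z * w' s z ∂τ) / (∫ z, w s z ∂τ)
          - ((∫ z, G z * w s z ∂τ) / (∫ z, w s z ∂τ)) * ((∫ z, w' s z ∂τ) / (∫ z, w s z ∂τ))) :=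
  sub_eq_integral_of_hasDerivAt (f := fun s => (∫ z, G z * w s z ∂τ) / (∫ z, w s z ∂τ))
    (fun s hs => hasDerivAt_normMean (hU.mem_nhds (hUI hs)) hG hmeas (hint s hs) (hintG s hs) (hmeas' s) hbound hbint
      hboundG hbGint hdiff (hZ s hs)) hi

/-- ★★ **THE LAW EDGE OF A COVARIANCE IS BOUNDED BY THE PATH THIRD CUMULANT** (the (JV3-h′) shape): if the §2 data hold on an open `U ⊇ [0,1]` and the
path derivative of ★`hasDerivAt_normCov` is `≤ ℓ` in absolute value on `[0,1]`, then the uncentred covariances at the two ends differ by at most `ℓ`. [folklore] -/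
theorem abs_normCov_one_sub_zero_le {w w' : ℝ → Z → ℝ} {A B : Z → ℝ} {U : Set ℝ} (hU : IsOpen U) (hUI : Icc (0:ℝ) 1 ⊆ U)
    (hA : AEStronglyMeasurable A τ) (hB : AEStronglyMeasurable B τ)
    (hmeas : ∀ s, AEStronglyMeasurable (w s) τ) (hmeas' : ∀ s, AEStronglyMeasurable (w' s) τ)
    (hint : ∀ s ∈ Icc (0:ℝ) 1, Integrable (w s) τ) (hintA : ∀ s ∈ Icc (0:ℝ) 1, Integrable (fun z => A z * w s z) τ)
    (hintB : ∀ s ∈ Icc (0:ℝ) 1, Integrable (fun z => B z * w s z) τ)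
    (hintAB : ∀ s ∈ Icc (0:ℝ) 1, Integrable (fun z => (A z * B z) * w s z) τ)
    {bound : Z → ℝ} (hbound : ∀ᵐ z ∂τ, ∀ s ∈ U, |w' s z| ≤ bound z) (hbint : Integrable bound τ)
    {boundA : Z → ℝ} (hboundA : ∀ᵐ z ∂τ, ∀ s ∈ U, |A z * w' s z| ≤ boundA z) (hbAint : Integrable boundA τ)
    {boundB : Z → ℝ} (hboundB : ∀ᵐ z ∂τ, ∀ s ∈ U, |B z * w' s z| ≤ boundB z) (hbBint : Integrable boundB τ)
    {boundAB : Z → ℝ} (hboundAB : ∀ᵐ z ∂τ, ∀ s ∈ U, |(A z * B z) * w' s z| ≤ boundAB z) (hbABint : Integrable boundAB τ)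
    (hdiff : ∀ᵐ z ∂τ, ∀ s ∈ U, HasDerivAt (fun s => w s z) (w' s z) s)
    (hZ : ∀ s ∈ Icc (0:ℝ) 1, ∫ z, w s z ∂τ ≠ 0) {ℓ : ℝ}
    (hcum : ∀ s ∈ Icc (0:ℝ) 1,
      |((∫ z, (A z * B z) * w' s z ∂τ) / (∫ z, w s z ∂τ)
          - ((∫ z, (A z * B z) * w s z ∂τ) / (∫ z, w s z ∂τ)) * ((∫ z, w' s z ∂τ) / (∫ z, w s z ∂τ)))
        - (((∫ z, A z * w' s z ∂τ) / (∫ z, w s z ∂τ)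
              - ((∫ z, A z * w s z ∂τ) / (∫ z, w s z ∂τ)) * ((∫ z, w' s z ∂τ) / (∫ z, w s z ∂τ)))
            * ((∫ z, B z * w s z ∂τ) / (∫ z, w s z ∂τ))
          + ((∫ z, A z * w s z ∂τ) / (∫ z, w s z ∂τ))
            * ((∫ z, B z * w' s z ∂τ) / (∫ z, w s z ∂τ)
              - ((∫ z, B z * w s z ∂τ) / (∫ z, w s z ∂τ)) * ((∫ z, w' s z ∂τ) / (∫ z, w s z ∂τ))))| ≤ ℓ) :
    |((∫ z, (A z * B z) * w 1 z ∂τ) / (∫ z, w 1 z ∂τ)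
        - ((∫ z, A z * w 1 z ∂τ) / (∫ z, w 1 z ∂τ)) * ((∫ z, B z * w 1 z ∂τ) / (∫ z, w 1 z ∂τ)))
      - ((∫ z, (A z * B z) * w 0 z ∂τ) / (∫ z, w 0 z ∂τ)
        - ((∫ z, A z * w 0 z ∂τ) / (∫ z, w 0 z ∂τ)) * ((∫ z, B z * w 0 z ∂τ) / (∫ z, w 0 z ∂τ)))| ≤ ℓ :=
  abs_sub_le_of_hasDerivAt_of_abs_le
    (f := fun s => (∫ z, (A z * B z) * w s z ∂τ) / (∫ z, w s z ∂τ)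
        - ((∫ z, A z * w s z ∂τ) / (∫ z, w s z ∂τ)) * ((∫ z, B z * w s z ∂τ) / (∫ z, w s z ∂τ)))
    (fun s hs => hasDerivAt_normCov (hU.mem_nhds (hUI hs)) hA hB hmeas (hint s hs) (hintA s hs) (hintB s hs) (hintAB s hs) (hmeas' s)
      hbound hbint hboundA hbAint hboundB hbBint hboundAB hbABint hdiff (hZ s hs)) hcum

end Abstract

end Summit.QuantumFields.YangMills.Theorems.OrganTangentLawEdgeResponse

end
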